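import Literature.Geometry.Lorentzian.GeodesicExtension
import Literature.Geometry.Lorentzian.GeodesicUniformTime
import Literature.Geometry.Lorentzian.ChartCalculus
import Literature.Geometry.Lorentzian.Basic

/-!
# Crux `HonestFixedRadiusSettling` · line `sojourn-needs-only-one-over-delta` · stub `stub_farExit`
# Layer H2 (a): the escape lemma for maximal geodesics, and compact tangent sets over a chart

Helper file for `stmt-FinalStateConjecture-13550` (stub `stub_farExit`, the maximality endgame of
the exact-Kerr transport). Two general facts about geodesics of a `C¹` covariant derivative on a
Hausdorff manifold without boundary (framework of `Literature.Geometry.Lorentzian.Geodesic`):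

* `not_bddAbove_of_tangentLift_mem` — **the escape lemma** (Lee, *Introduction to Riemannian
  Manifolds* (2018), Lemma 6.19; O'Neill 1983, Ch. 5, Lemma 8): a MAXIMAL geodesic whose tangent
  lifts `(γ t, γ' t)` stay, for all late parameters, in a compact subset of `TM` has a parameter
  domain unbounded above. Proof: a uniform existence time `ε` on the compact set
  (`exists_uniform_isGeodesicOn_of_isCompact`) lets one glue, at a parameter `t₁` within `ε/2` of
  the supremum `T` of the domain, the uniform-time geodesic through `(γ t₁, γ' t₁)`
  (`IsGeodesicOn.exists_extend`, `IsGeodesicOn.piecewise`), producing a geodesic on the strictly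
  larger interval `dom ∪ (t₁ − δ, t₁ + ε) ∋ T`, against maximality.
* `isCompact_setOf_tangent` — over an open subset `U` of a finite-dimensional normed space the
  tangent bundle is trivialised by the identity (`OpensChart.trivializationAt_apply`), so the set
  of tangent vectors with foot point in a compact `K ⊆ U` and fibre norm `≤ V` is compact.

References: J. M. Lee, *Introduction to Riemannian Manifolds*, 2nd ed. (2018), Lemma 6.19 and
Cor. 6.20; B. O'Neill, *Semi-Riemannian geometry* (1983), Ch. 3, Lemma 22–23 and Ch. 5, Lemma 8.
-/

set_option linter.dupNamespace false

noncomputable section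

open Literature.Geometry.Lorentzian
open scoped Manifold ContDiff Topology
open Bundle Filter Set Metric TopologicalSpace

namespace Summit.FinalStateConjecture.FinalStateConjecture.Theorems.StarvedNecks.OneOverDelta.Escape

/-! ## The escape lemma -/

section Escape

variable {E : Type*} [NormedAddCommGroup E] [NormedSpace ℝ E] {H : Type*} [TopologicalSpace H]
  {I : ModelWithCorners ℝ E H} {M : Type*} [TopologicalSpace M] [ChartedSpace H M]
  [IsManifold I ∞ M] [FiniteDimensional ℝ E]
  {cov : CovariantDerivative I E (TangentSpace I : M → Type _)}

/-- In `ℝ`, the union of two intervals sharing a point is an interval. [folklore] -/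
theorem ordConnected_union {s t : Set ℝ} (hs : s.OrdConnected) (ht : t.OrdConnected) {x : ℝ}
    (hxs : x ∈ s) (hxt : x ∈ t) : (s ∪ t).OrdConnected :=
  isPreconnected_iff_ordConnected.1
    (IsPreconnected.union x hxs hxt (isPreconnected_iff_ordConnected.2 hs)
      (isPreconnected_iff_ordConnected.2 ht))

/-- **Escape lemma for maximal geodesics** (Lee 2018, Lemma 6.19; O'Neill 1983, Ch. 5, Lemma 8).
Let `γ` be a maximal geodesic of a `C¹` connection on a Hausdorff manifold without boundary, with
domain `dom ∋ t₀`, and let `𝒦 ⊆ TM` be compact. If `(γ t, γ' t) ∈ 𝒦` for every `t ∈ dom` with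
`t ≥ t₀`, then `dom` is unbounded above. [cite: Lee2018, Lemma 6.19] -/
theorem not_bddAbove_of_tangentLift_mem [CompleteSpace E] [T2Space M] [BoundarylessManifold I M]
    [CovariantDerivative.ContMDiffCovariantDerivative cov 1]
    {γ : ℝ → M} {dom : Set ℝ} (hγ : IsMaximalGeodesicOn cov γ dom)
    {𝒦 : Set (TangentBundle I M)} (h𝒦 : IsCompact 𝒦) {t₀ : ℝ} (ht₀ : t₀ ∈ dom)
    (hmem : ∀ t ∈ dom, t₀ ≤ t → tangentLift I γ t ∈ 𝒦) : ¬ BddAbove dom := by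
  classical
  intro hbdd
  obtain ⟨ε, hε, huni⟩ := exists_uniform_isGeodesicOn_of_isCompact (cov := cov) h𝒦
  set T := sSup dom with hT_def
  have hne : dom.Nonempty := ⟨t₀, ht₀⟩
  have hopen : IsOpen dom := hγ.isOpen
  have hoc : dom.OrdConnected := hγ.2.1
  -- the supremum is not attained (the domain is open)
  have hT_notin : T ∉ dom := fun hT ↦ by
    obtain ⟨δ, hδ, hball⟩ := Metric.isOpen_iff.1 hopen T hT
    have h1 : T + δ / 2 ∈ dom := hball (by
      rw [Metric.mem_ball, Real.dist_eq, abs_of_pos (by linarith)]; linarith)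
    have := le_csSup hbdd h1
    linarith
  have hlt : ∀ t ∈ dom, t < T := fun t ht ↦
    lt_of_le_of_ne (le_csSup hbdd ht) fun h ↦ hT_notin (h ▸ ht)
  -- a parameter `t₁ ∈ dom`, `t₁ ≥ t₀`, within `ε/2` of `T`
  obtain ⟨t₁', ht₁'dom, ht₁'⟩ := exists_lt_of_lt_csSup hne (show T - ε / 2 < T by linarith)
  set t₁ := max t₁' t₀ with ht₁_def
  have ht₁dom : t₁ ∈ dom := by
    rcases le_total t₁' t₀ with h | h
    · rw [ht₁_def, max_eq_right h]; exact ht₀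
    · rw [ht₁_def, max_eq_left h]; exact ht₁'dom
  have ht₁T : T - ε / 2 < t₁ := lt_of_lt_of_le ht₁' (le_max_left _ _)
  have ht₀t₁ : t₀ ≤ t₁ := le_max_right _ _
  have ht₁ltT : t₁ < T := hlt t₁ ht₁dom
  -- `[t₁, T) ⊆ dom`
  have hIco : Ico t₁ T ⊆ dom := fun t ht ↦ by
    obtain ⟨t', ht'dom, htt'⟩ := exists_lt_of_lt_csSup hne ht.2
    exact hoc.out ht₁dom ht'dom ⟨ht.1, htt'.le⟩
  -- a small interval around `t₁` inside `dom`; shrink below `ε`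
  obtain ⟨δ₀, hδ₀, hballδ⟩ := Metric.isOpen_iff.1 hopen t₁ ht₁dom
  set δ := min δ₀ ε with hδ_def
  have hδ : 0 < δ := lt_min hδ₀ hε
  have hδε : δ ≤ ε := min_le_right _ _
  have hIoo : Ioo (t₁ - δ) T ⊆ dom := fun t ht ↦ by
    by_cases h : t < t₁
    · refine hballδ ?_
      rw [Metric.mem_ball, Real.dist_eq, abs_lt]
      constructor <;> linarith [ht.1, min_le_left δ₀ ε]
    · exact hIco ⟨not_lt.1 h, ht.2⟩
  -- the uniform-time geodesic through `(γ t₁, γ' t₁)` extends `γ` beyond `T`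
  obtain ⟨β, hβ, hβ0⟩ := huni _ (hmem t₁ ht₁dom ht₀t₁)
  have hγ' : IsGeodesicOn cov γ (Ioo (t₁ - δ) T) := hγ.isGeodesicOn.mono hIoo
  obtain ⟨γ₁, hγ₁, hγ₁γ⟩ := hγ'.exists_extend ⟨by linarith, ht₁ltT⟩ hβ hβ0
  set V : Set ℝ := Ioo (t₁ - δ) (t₁ + ε) with hV_def
  have hVsub : V ⊆ Ioo (t₁ - δ) T ∪ Ioo (t₁ - ε) (t₁ + ε) := fun t ht ↦ by
    by_cases h : t < T
    · exact Or.inl ⟨ht.1, h⟩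
    · exact Or.inr ⟨by linarith [ht.1], ht.2⟩
  have hγ₁V : IsGeodesicOn cov γ₁ V := hγ₁.mono hVsub
  have ht₁V : t₁ ∈ V := ⟨by linarith, by linarith⟩
  -- glue `γ` on `dom` with `γ₁` on `V`
  have hlift : tangentLift I γ t₁ = tangentLift I γ₁ t₁ := by
    refine (tangentLift_congr_of_eventuallyEq ?_).symm
    exact Filter.eventuallyEq_of_mem (isOpen_Ioo.mem_nhds ⟨by linarith, ht₁ltT⟩) hγ₁γ
  obtain ⟨hg, hgγ, -⟩ := hγ.isGeodesicOn.piecewise hopen isOpen_Ioo (hoc.inter ordConnected_Ioo)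
    hγ₁V ⟨ht₁dom, ht₁V⟩ hlift
  have hunion : dom ∪ V = dom :=
    hγ.2.2.2 _ (dom ∪ V) (hopen.union isOpen_Ioo) (ordConnected_union hoc ordConnected_Ioo ht₁dom ht₁V)
      subset_union_left hg hgγ.symm
  have hTV : T ∈ V := ⟨by linarith, by linarith⟩
  exact hT_notin (hunion ▸ Or.inr hTV)

/-- **Deciding theorem of this helper file (registered stub `farExit_escape`)**: the escape lemma
on four-dimensional manifolds charted on `E4` (the flat chart domain and the development alike).
[cite: Lee2018, Lemma 6.19] -/
theorem farExit_escape : ∀ {M : Type} [TopologicalSpace M] [ChartedSpace E4 M] [IsManifold (𝓡 4) ∞ M] [T2Space M] {cov : CovariantDerivative (𝓡 4) E4 (TangentSpace (𝓡 4) : M → Type)} [CovariantDerivative.ContMDiffCovariantDerivative cov 1] {γ : ℝ → M} {dom : Set ℝ}, IsMaximalGeodesicOn cov γ dom → ∀ {𝒦 : Set (TangentBundle (𝓡 4) M)}, IsCompact 𝒦 → ∀ {t₀ : ℝ}, t₀ ∈ dom → (∀ t ∈ dom, t₀ ≤ t → tangentLift (𝓡 4) γ t ∈ 𝒦) → ¬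 BddAbove dom :=
  fun hγ _ h𝒦 _ ht₀ hmem ↦ not_bddAbove_of_tangentLift_mem hγ h𝒦 ht₀ hmem

end Escape

/-! ## Compact sets of tangent vectors over a chart -/

section Compact

variable {E : Type*} [NormedAddCommGroup E] [NormedSpace ℝ E] [FiniteDimensional ℝ E]

/-- **Compact tangent sets over an open subset of a normed space.** For `U : Opens E` (`E`
finite-dimensional), a compact `K ⊆ U` and `V : ℝ`, the set of tangent vectors `p ∈ TU` with foot
point in `K` and `‖p‖ ≤ V` is compact: `TU` is globally trivialised by `⟨z, v⟩ ↦ (z, v)`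
(`OpensChart.trivializationAt_apply`), and the set is the image of `K × B̄(0, V)`. [folklore] -/
theorem isCompact_setOf_tangent {U : Opens E} {K : Set E} (hK : IsCompact K) (hKU : K ⊆ (U : Set E))
    (V : ℝ) : IsCompact {p : TangentBundle 𝓘(ℝ, E) U | (p.proj : E) ∈ K ∧ ‖(show E from p.2)‖ ≤ V} := by
  rcases K.eq_empty_or_nonempty with rfl | ⟨k, hk⟩
  · convert isCompact_empty using 1
    ext p
    simp
  haveI : ProperSpace E := FiniteDimensional.proper_real E
  set x₀ : U := ⟨k, hKU hk⟩ with hx₀_def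
  set e := trivializationAt E (TangentSpace 𝓘(ℝ, E)) x₀ with he_def
  have hbase : e.baseSet = univ := by
    rw [he_def, TangentBundle.trivializationAt_baseSet, OpensChart.chartAt_source]
  have hsrc : e.source = univ := by rw [e.source_eq, hbase, preimage_univ]
  have htgt : e.target = univ := by rw [e.target_eq, hbase, univ_prod_univ]
  set KU : Set U := Subtype.val ⁻¹' K with hKU_def
  have hKUc : IsCompact KU := by
    refine (Topology.IsEmbedding.subtypeVal.isCompact_iff).2 ?_
    rwa [image_preimage_eq_inter_range, Subtype.range_coe, inter_eq_left.2 hKU]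
  have hC : IsCompact (KU ×ˢ closedBall (0 : E) V) := hKUc.prod (isCompact_closedBall 0 V)
  have hcont : ContinuousOn e.toPartialHomeomorph.symm (KU ×ˢ closedBall (0 : E) V) :=
    e.toPartialHomeomorph.continuousOn_symm.mono (by rw [htgt]; exact subset_univ _)
  have hleft : ∀ (z : U) (v : E),
      e.toPartialHomeomorph.symm ((z : U), v) = (⟨z, v⟩ : TangentBundle 𝓘(ℝ, E) U) := by
    intro z v
    rw [← OpensChart.trivializationAt_apply x₀ z v]
    exact e.toPartialHomeomorph.left_inv (show (⟨z, v⟩ : TangentBundle 𝓘(ℝ, E) U) ∈ e.source by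
      rw [hsrc]; trivial)
  have heq : {p : TangentBundle 𝓘(ℝ, E) U | (p.proj : E) ∈ K ∧ ‖(show E from p.2)‖ ≤ V} =
      e.toPartialHomeomorph.symm '' (KU ×ˢ closedBall (0 : E) V) := by
    ext p
    constructor
    · rintro ⟨hp1, hp2⟩
      refine ⟨((p.proj : U), p.2), ⟨hp1, by simpa using hp2⟩, ?_⟩
      exact hleft p.proj p.2
    · rintro ⟨⟨z, v⟩, ⟨hz, hv⟩, rfl⟩
      rw [hleft z v]
      exact ⟨hz, by simpa using hv⟩
  rw [heq]
  exact hC.image_of_continuousOn hcont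

end Compact

end Summit.FinalStateConjecture.FinalStateConjecture.Theorems.StarvedNecks.OneOverDelta.Escape

end
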